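import Mathlib.LinearAlgebra.CrossProduct
import Literature.Analysis.FunctionSpaces.LatticeSobolev
import Literature.Analysis.FluidPDE.TorusABCFlow
import Literature.Analysis.FluidPDE.LinearisedNSLatticeEigenvalue

/-!
# The linearised Navier–Stokes operator about the ABC flow on the Fourier lattice `ℤ³`:
# closed six-neighbour form, locality, growth, and the `U × (curl v − v)` (Lamb) form of the certifiers
(instab3 g4 — implementation 1 of the skew-cut X0 certifier, cell `ns-blowup`, 2026-08-26)

HONEST FRAMING (human ruling D-0035): nothing here is a claim about Navier–Stokes blow-up.
WHAT THIS IS NOT: not NS evidence. MODEL lane — exact Fourier bookkeeping of ONE linear operator,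
the linearisation `L(ν, U) w = νΔw − (U·∇)w − (w·∇)U − ∇q` of the Navier–Stokes system about the ABC
flow `U = Torus.abcFlow A B C` on the unit torus `T³` (`LinearizedNSTorus`), i.e. the operator whose
real class-II eigenvalue the cell's skew-cut certificates bracket (`SkewCutCertificate`,
`SkewCutBracketTranscript`, KERNEL-CHAIN.md of HOME/instab4). It supplies the OPERATOR-SPECIFIC part
of the ASSEMBLY obligations (A2)/(A6) of that chain, on the lattice side and in the tree's own
vocabulary (`ScalarFourier.transportSym`, `Torus.lerayCoeff`, `mFourierCoeff (complexify ∘ abcFlow)`):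

* §1 shell bookkeeping: lattice sums against the ABC coefficient family `â = 𝓕(U)` (supported on the
  six frequencies `q_y = Torus.abcDir y`, `y : Fin 3 × Bool`, with values `Torus.abcCoeff`) are finite
  six-term sums (`tsum_abcFourier_eq_sum`).
* §2 **closed form** (`linSym_abcFlow_eq`): the linearised convective symbol
  `M(c)(k) := N(â, c)(k) + N(c, â)(k)` (`N = transportSym` componentwise, the Fourier side of
  `(U·∇)w + (w·∇)U`) is, for EVERY coefficient family `c : ℤ³ → ℂ³` and every `k`,
  `M(c)(k) = ∑_y [ 2πi ((k − q_y)·â(q_y)) c(k − q_y) + 2πi (q_y·c(k − q_y)) â(q_y) ]`.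
* §3 **locality / band** (`linSym_abcFlow_congr`): `M(c)(k)` depends only on the six neighbours
  `c(k − q_y)`; **growth** (`norm_linSym_abcFlow_le`):
  `‖M(c)(k)‖ ≤ 18π ∑_y ‖â(q_y)‖ ⟨k − q_y⟩ ‖c(k − q_y)‖` (first order), with `‖â(±eⱼ)‖² = aⱼ²/2`
  (`norm_sq_abcCoeff_abcDir`).
* §4 **the certifiers' form** (`lerayCoeff_linSym_abcFlow_eq_cross`): after the Leray multiplier,
  `Π_k M(c)(k) = −2π · Π_k ∑_y â(q_y) × ( i (k − q_y) × c(k − q_y) − c(k − q_y) )` — the mode-by-mode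
  form of the Lamb identity `U × curl w − U × w = ∇(U·w) − (U·∇)w − (w·∇)U` for the Beltrami host
  (`curl U = 2πU` on the unit torus, i.e. `i q × â(q) = â(q)`, `Torus.abcCoeff_eigen`): the operator
  `v ↦ P[U × (curl v − v)]` of INSTAB3-METHOD §1 / SKEWCUT-CERT (period-`2π` units) IS `−(2π)⁻¹` times the
  tree's linearised convective operator in Fourier variables (`cross_form_pointwise` is the vector identity).
* §5 **end-to-end** (`isLinNSEigenvalue_abcFlow_of_lattice`, `isLinNSEigenvalue_abcFlow_of_crossForm`): a
  rapidly decaying transversal mean-free non-zero lattice solution of `L c = μ c` (closed form, resp. the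
  certifiers' cross-product form in their units) IS a classical eigenpair:
  `Torus.IsLinNSEigenvalue ν (abcFlow A B C) μ`, resp. `Torus.IsLinNSEigenvalue (ν/(2π)) (abcFlow A B C) (2πμ)`
  (KERNEL-CHAIN (A6) SYNTHESIS for the model, via the tree's `SteadyLattice.isLinNSEigenvalue_of_fourier_eigen`).
  What remains between the two certifiers' numbers and this door is lattice-side linear algebra only:
  coordinates (Craya / helical frames of `k^⊥`), the class-II restriction, the identification of the
  finite sections with the transcribed matrices, and `∑ w^{2s}|v_i|² < ∞ ∀ s ⇒ RapidDecay`.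

Units: on `(ℝ/2πℤ)³` with `ν = 1/R` the certifiers' operator is `L v = P[U × (curl v − v)] + νΔv`; on the
unit torus `T³` the same coefficient families give `2π·L`, so `λ` there is `2πλ` here and `ν` there is
`ν/(2π)` here (as in `AbcLyapunovInstability`'s docstring). Mathlib + Literature only; no definitions.
-/

noncomputable section

open scoped BigOperators Topology InnerProductSpace ComplexConjugate Matrix
open Filter Set Function MeasureTheory UnitAddTorus Finset

namespace Summit.NavierStokesRegularity.FluidComputer.AbcLinearisedLattice

open Literature.Analysis.FluidPDE Literature.Analysis.FluidPDE.SteadyLattice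
open Literature.Analysis.FunctionSpaces Literature.Analysis.FunctionSpaces.Torus
open Literature.Analysis.FunctionSpaces.EuclideanSpace
open Literature.Analysis.FluidPDE.ScalarFourier

/-! ### §1 Shell bookkeeping: sums against `â = 𝓕(U)` are six-term sums -/

/-- A lattice sum of terms `F m (â m)` that vanish where `â` does is the six-term sum over the ABC shell
`{±eⱼ}`: `∑' m, F m (â m) = ∑_y F (q_y) (abcCoeff q_y)`, `q_y = Torus.abcDir y`. -/
theorem tsum_abcFourier_eq_sum {E : Type*} [AddCommMonoid E] [TopologicalSpace E] (A B C : ℝ)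
    (F : (Fin 3 → ℤ) → EuclideanSpace ℂ (Fin 3) → E) (hF : ∀ m, F m 0 = 0) :
    ∑' m, F m (mFourierCoeff (complexify ∘ Torus.abcFlow A B C) m) =
      ∑ y : Fin 3 × Bool, F (Torus.abcDir y) (Torus.abcCoeff A B C (Torus.abcDir y)) := by
  have hsupp : ∀ m ∉ Torus.abcFreq, F m (mFourierCoeff (complexify ∘ Torus.abcFlow A B C) m) = 0 := by
    intro m hm
    rw [Torus.mFourierCoeff_abcFlow, if_neg hm, hF]
  rw [tsum_eq_sum hsupp, Torus.sum_abcFreq]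
  refine Finset.sum_congr rfl fun y _ => ?_
  rw [Torus.mFourierCoeff_abcFlow, if_pos (Torus.mem_abcFreq.mpr ⟨y, rfl⟩)]

/-- The first convective symbol against the ABC host, componentwise:
`N(â, c)(k)ₚ = ∑_y (∑ⱼ â(q_y)ⱼ · 2πi (k − q_y)ⱼ) c(k − q_y)ₚ`. -/
theorem transportSym_abc_left_apply (A B C : ℝ) (c : (Fin 3 → ℤ) → EuclideanSpace ℂ (Fin 3))
    (k : Fin 3 → ℤ) (p : Fin 3) :
    transportSym (fun jj mm => (mFourierCoeff (complexify ∘ Torus.abcFlow A B C)) mm jj) (fun mm => c mm p) k =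
      ∑ y : Fin 3 × Bool, (∑ j : Fin 3, Torus.abcCoeff A B C (Torus.abcDir y) j * dsym j (k - Torus.abcDir y)) *
        c (k - Torus.abcDir y) p := by
  rw [transportSym_apply]
  simp_rw [lconv_apply]
  have h : ∀ j : Fin 3, ∑' m, (mFourierCoeff (complexify ∘ Torus.abcFlow A B C)) m j *
      (dsym j (k - m) * c (k - m) p) = ∑ y : Fin 3 × Bool, Torus.abcCoeff A B C (Torus.abcDir y) j *
      (dsym j (k - Torus.abcDir y) * c (k - Torus.abcDir y) p) := fun j =>
    tsum_abcFourier_eq_sum A B C (fun m v => v j * (dsym j (k - m) * c (k - m) p)) (fun m => by simp)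
  simp_rw [h]
  rw [Finset.sum_comm]
  refine Finset.sum_congr rfl fun y _ => ?_
  rw [Finset.sum_mul]
  exact Finset.sum_congr rfl fun j _ => by ring

/-- The second convective symbol against the ABC host, componentwise:
`N(c, â)(k)ₚ = ∑_y (∑ⱼ c(k − q_y)ⱼ · 2πi (q_y)ⱼ) â(q_y)ₚ` (reindex `m ↦ k − m`). -/
theorem transportSym_abc_right_apply (A B C : ℝ) (c : (Fin 3 → ℤ) → EuclideanSpace ℂ (Fin 3))
    (k : Fin 3 → ℤ) (p : Fin 3) :
    transportSym (fun jj mm => c mm jj) (fun mm => (mFourierCoeff (complexify ∘ Torus.abcFlow A B C)) mm p) k =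
      ∑ y : Fin 3 × Bool, (∑ j : Fin 3, c (k - Torus.abcDir y) j * dsym j (Torus.abcDir y)) *
        Torus.abcCoeff A B C (Torus.abcDir y) p := by
  rw [transportSym_apply]
  simp_rw [lconv_apply]
  have h : ∀ j : Fin 3, ∑' m, c m j * (dsym j (k - m) * (mFourierCoeff (complexify ∘ Torus.abcFlow A B C))
      (k - m) p) = ∑ y : Fin 3 × Bool, c (k - Torus.abcDir y) j * (dsym j (Torus.abcDir y) *
      Torus.abcCoeff A B C (Torus.abcDir y) p) := by
    intro j
    have hre : ∑' m, c m j * (dsym j (k - m) * (mFourierCoeff (complexify ∘ Torus.abcFlow A B C)) (k - m) p) =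
        ∑' m, c (k - m) j * (dsym j m * (mFourierCoeff (complexify ∘ Torus.abcFlow A B C)) m p) := by
      rw [← (Equiv.subLeft k).tsum_eq]
      refine tsum_congr fun m => ?_
      simp only [Equiv.subLeft_apply, sub_sub_cancel]
    rw [hre]
    exact tsum_abcFourier_eq_sum A B C (fun m v => c (k - m) j * (dsym j m * v p)) (fun m => by simp)
  simp_rw [h]
  rw [Finset.sum_comm]
  refine Finset.sum_congr rfl fun y _ => ?_
  rw [Finset.sum_mul]
  exact Finset.sum_congr rfl fun j _ => by ring

/-! ### §2 The closed six-neighbour form of the linearised convective symbol -/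

/-- **Closed form of the linearised convective symbol about the ABC flow.** For every coefficient
family `c : ℤ³ → ℂ³` and every frequency `k`,
`N(â, c)(k) + N(c, â)(k)
   = ∑_y [ (2πi ∑ⱼ (k − q_y)ⱼ â(q_y)ⱼ) • c(k − q_y) + (2πi ∑ⱼ (q_y)ⱼ c(k − q_y)ⱼ) • â(q_y) ]`
— the Fourier side of `(U·∇)w + (w·∇)U` for `U = abcFlow A B C`, a SIX-NEIGHBOUR (banded, first-order)
lattice operator. -/
theorem linSym_abcFlow_eq (A B C : ℝ) (c : (Fin 3 → ℤ) → EuclideanSpace ℂ (Fin 3)) (k : Fin 3 → ℤ) :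
    (WithLp.toLp 2 (fun pp : Fin 3 => transportSym (fun jj mm => (mFourierCoeff (complexify
        ∘ Torus.abcFlow A B C)) mm jj) (fun mm => c mm pp) k) : EuclideanSpace ℂ (Fin 3)) +
      (WithLp.toLp 2 (fun pp : Fin 3 => transportSym (fun jj mm => c mm jj) (fun mm => (mFourierCoeff
        (complexify ∘ Torus.abcFlow A B C)) mm pp) k) : EuclideanSpace ℂ (Fin 3)) =
      ∑ y : Fin 3 × Bool, ((2 * Real.pi * Complex.I * ∑ j : Fin 3, (((k - Torus.abcDir y) j : ℤ) : ℂ) *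
          Torus.abcCoeff A B C (Torus.abcDir y) j) • c (k - Torus.abcDir y) +
        (2 * Real.pi * Complex.I * ∑ j : Fin 3, ((Torus.abcDir y j : ℤ) : ℂ) * c (k - Torus.abcDir y) j) •
          Torus.abcCoeff A B C (Torus.abcDir y)) := by
  ext p
  rw [PiLp.add_apply, PiLp.toLp_apply, PiLp.toLp_apply, transportSym_abc_left_apply,
    transportSym_abc_right_apply, ← Finset.sum_add_distrib]
  simp only [WithLp.ofLp_sum, WithLp.ofLp_add, WithLp.ofLp_smul, Finset.sum_apply, Pi.add_apply,
    Pi.smul_apply, smul_eq_mul]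
  refine Finset.sum_congr rfl fun y _ => ?_
  simp only [dsym_apply, Finset.mul_sum]
  congr 1
  · congr 1
    exact Finset.sum_congr rfl fun j _ => by ring
  · congr 1
    exact Finset.sum_congr rfl fun j _ => by ring

/-! ### §3 Locality (band) and first-order growth -/

/-- **Locality**: the symbol at `k` sees only the six neighbours `c(k − q_y)`. -/
theorem linSym_abcFlow_congr (A B C : ℝ) {c c' : (Fin 3 → ℤ) → EuclideanSpace ℂ (Fin 3)} {k : Fin 3 → ℤ}
    (h : ∀ y : Fin 3 × Bool, c (k - Torus.abcDir y) = c' (k - Torus.abcDir y)) :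
    (WithLp.toLp 2 (fun pp : Fin 3 => transportSym (fun jj mm => (mFourierCoeff (complexify
        ∘ Torus.abcFlow A B C)) mm jj) (fun mm => c mm pp) k) : EuclideanSpace ℂ (Fin 3)) +
      (WithLp.toLp 2 (fun pp : Fin 3 => transportSym (fun jj mm => c mm jj) (fun mm => (mFourierCoeff
        (complexify ∘ Torus.abcFlow A B C)) mm pp) k) : EuclideanSpace ℂ (Fin 3)) =
    (WithLp.toLp 2 (fun pp : Fin 3 => transportSym (fun jj mm => (mFourierCoeff (complexify
        ∘ Torus.abcFlow A B C)) mm jj) (fun mm => c' mm pp) k) : EuclideanSpace ℂ (Fin 3)) +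
      (WithLp.toLp 2 (fun pp : Fin 3 => transportSym (fun jj mm => c' mm jj) (fun mm => (mFourierCoeff
        (complexify ∘ Torus.abcFlow A B C)) mm pp) k) : EuclideanSpace ℂ (Fin 3)) := by
  rw [linSym_abcFlow_eq, linSym_abcFlow_eq]
  exact Finset.sum_congr rfl fun y _ => by rw [h y]

/-- In particular the symbol at `k` vanishes when the six neighbours do (e.g. outside the cube
`‖k‖_∞ ≤ K + 1` for a family supported in `‖·‖_∞ ≤ K`). -/
theorem linSym_abcFlow_eq_zero_of_neighbours (A B C : ℝ) {c : (Fin 3 → ℤ) → EuclideanSpace ℂ (Fin 3)}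
    {k : Fin 3 → ℤ} (h : ∀ y : Fin 3 × Bool, c (k - Torus.abcDir y) = 0) :
    (WithLp.toLp 2 (fun pp : Fin 3 => transportSym (fun jj mm => (mFourierCoeff (complexify
        ∘ Torus.abcFlow A B C)) mm jj) (fun mm => c mm pp) k) : EuclideanSpace ℂ (Fin 3)) +
      (WithLp.toLp 2 (fun pp : Fin 3 => transportSym (fun jj mm => c mm jj) (fun mm => (mFourierCoeff
        (complexify ∘ Torus.abcFlow A B C)) mm pp) k) : EuclideanSpace ℂ (Fin 3)) = 0 := by
  rw [linSym_abcFlow_eq]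
  exact Finset.sum_eq_zero fun y _ => by rw [h y]; simp


/-- **The size of the ABC coefficients**: `‖â(±eⱼ)‖² = aⱼ²/2` (`a = abcAmp A B C = (B, C, A)`; the
vector `½(∓i aⱼ 𝐞_{j+1} + aⱼ 𝐞_{j+2})` has two entries of modulus `|aⱼ|/2`). -/
theorem norm_sq_abcCoeff_abcDir (A B C : ℝ) (y : Fin 3 × Bool) :
    ‖Torus.abcCoeff A B C (Torus.abcDir y)‖ ^ 2 = (Torus.abcAmp A B C y.1) ^ 2 / 2 := by
  obtain ⟨j, b⟩ := y
  rw [EuclideanSpace.norm_sq_eq, Fin.sum_univ_three]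
  fin_cases j <;> cases b <;>
    simp [Torus.abcCoeff_apply, Torus.abcDir_apply, Fin.isValue] <;> ring_nf <;> simp [sq_abs]

/-- **First-order growth of the linearised convective symbol about the ABC flow**:
`‖N(â, c)(k) + N(c, â)(k)‖ ≤ 18π ∑_y ‖â(q_y)‖ ⟨k − q_y⟩ ‖c(k − q_y)‖`,
`⟨m⟩ = (1 + |m|²)^{1/2}` (`|m·v| ≤ 3⟨m⟩‖v‖`, `⟨q_y⟩ = √2 ≤ 2⟨k − q_y⟩`). -/
theorem norm_linSym_abcFlow_le (A B C : ℝ) (c : (Fin 3 → ℤ) → EuclideanSpace ℂ (Fin 3)) (k : Fin 3 → ℤ) :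
    ‖(WithLp.toLp 2 (fun pp : Fin 3 => transportSym (fun jj mm => (mFourierCoeff (complexify
        ∘ Torus.abcFlow A B C)) mm jj) (fun mm => c mm pp) k) : EuclideanSpace ℂ (Fin 3)) +
      (WithLp.toLp 2 (fun pp : Fin 3 => transportSym (fun jj mm => c mm jj) (fun mm => (mFourierCoeff
        (complexify ∘ Torus.abcFlow A B C)) mm pp) k) : EuclideanSpace ℂ (Fin 3))‖ ≤
      18 * Real.pi * ∑ y : Fin 3 × Bool, ‖Torus.abcCoeff A B C (Torus.abcDir y)‖ *
        sobolevWeight 1 (k - Torus.abcDir y) * ‖c (k - Torus.abcDir y)‖ := by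
  rw [linSym_abcFlow_eq, Finset.mul_sum]
  refine (norm_sum_le _ _).trans (Finset.sum_le_sum fun y _ => ?_)
  set q := Torus.abcDir y with hq
  set a := Torus.abcCoeff A B C q with ha
  set e := c (k - q) with he
  have hπ : 0 < Real.pi := Real.pi_pos
  have hw1 : 1 ≤ sobolevWeight 1 (k - q) := one_le_sobolevWeight zero_le_one _
  have hwq : sobolevWeight 1 q ≤ 2 := by
    rw [hq, sobolevWeight, Torus.freqNormSq_abcDir]
    have : ((1 : ℝ) + 1) ^ ((1 : ℝ) / 2) = Real.sqrt 2 := by rw [Real.sqrt_eq_rpow]; norm_num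
    rw [this]
    have h2 : Real.sqrt 2 ≤ Real.sqrt 4 := Real.sqrt_le_sqrt (by norm_num)
    have h4 : Real.sqrt 4 = 2 := by
      rw [show (4 : ℝ) = 2 ^ 2 by norm_num, Real.sqrt_sq (by norm_num : (0 : ℝ) ≤ 2)]
    linarith
  have h1 : ‖(2 * Real.pi * Complex.I * ∑ j : Fin 3, (((k - q) j : ℤ) : ℂ) * a j) • e‖ ≤
      2 * Real.pi * (3 * sobolevWeight 1 (k - q) * ‖a‖) * ‖e‖ := by
    rw [norm_smul, norm_mul]
    refine mul_le_mul_of_nonneg_right (mul_le_mul ?_ (norm_kdot_le (k - q) a) (norm_nonneg _)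
      (by positivity)) (norm_nonneg _)
    simp [Complex.norm_real, abs_of_pos hπ]
  have h2 : ‖(2 * Real.pi * Complex.I * ∑ j : Fin 3, ((q j : ℤ) : ℂ) * e j) • a‖ ≤
      2 * Real.pi * (3 * sobolevWeight 1 q * ‖e‖) * ‖a‖ := by
    rw [norm_smul, norm_mul]
    refine mul_le_mul_of_nonneg_right (mul_le_mul ?_ (norm_kdot_le q e) (norm_nonneg _)
      (by positivity)) (norm_nonneg _)
    simp [Complex.norm_real, abs_of_pos hπ]
  have ha0 : 0 ≤ ‖a‖ := norm_nonneg _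
  have he0 : 0 ≤ ‖e‖ := norm_nonneg _
  calc ‖(2 * Real.pi * Complex.I * ∑ j : Fin 3, (((k - q) j : ℤ) : ℂ) * a j) • e +
        (2 * Real.pi * Complex.I * ∑ j : Fin 3, ((q j : ℤ) : ℂ) * e j) • a‖
      ≤ 2 * Real.pi * (3 * sobolevWeight 1 (k - q) * ‖a‖) * ‖e‖ +
          2 * Real.pi * (3 * sobolevWeight 1 q * ‖e‖) * ‖a‖ :=
        (norm_add_le _ _).trans (add_le_add h1 h2)
    _ ≤ 2 * Real.pi * (3 * sobolevWeight 1 (k - q) * ‖a‖) * ‖e‖ +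
        2 * Real.pi * (3 * (2 * sobolevWeight 1 (k - q)) * ‖e‖) * ‖a‖ := by
        gcongr
        linarith
    _ = 18 * Real.pi * (‖a‖ * sobolevWeight 1 (k - q) * ‖e‖) := by ring

/-! ### §4 The certifiers' `U × (curl v − v)` (Lamb) form after the Leray multiplier -/

/-- **The vector identity behind the Lamb form** (pure linear algebra in `ℂ³`): if `i (q × a) = a`
(a Beltrami eigenvector coefficient) then for all `k', e`,
`a × (i (k' × e) − e) = i (a·e) (k' + q) − i (k'·a) e − i (q·e) a`
(`a × (k' × e) = (a·e)k' − (k'·a)e` and `−a × e = e × a = e × (i q × a) = i((e·a)q − (q·e)a)`). -/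
theorem cross_form_pointwise (a q k' e : Fin 3 → ℂ) (h : Complex.I • (q ⨯₃ a) = a) :
    a ⨯₃ (Complex.I • (k' ⨯₃ e) - e) =
      Complex.I • ((a ⬝ᵥ e) • (k' + q)) - Complex.I • ((k' ⬝ᵥ a) • e) -
        Complex.I • ((q ⬝ᵥ e) • a) := by
  have h1 : a ⨯₃ (k' ⨯₃ e) = (a ⬝ᵥ e) • k' - (k' ⬝ᵥ a) • e := cross_cross_eq_smul_sub_smul' a k' e
  have h2 : a ⨯₃ e = -(Complex.I • ((e ⬝ᵥ a) • q - (q ⬝ᵥ e) • a)) := by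
    rw [← cross_anticomm e a]
    conv_lhs => rw [← h]
    rw [map_smul, cross_cross_eq_smul_sub_smul']
  rw [map_sub, map_smul, h1, h2, dotProduct_comm e a]
  simp only [smul_sub, smul_add, sub_neg_eq_add]
  abel

/-- The Leray multiplier is additive over finite sums. -/
theorem lerayCoeff_finset_sum {β : Type*} (k : Fin 3 → ℤ) (s : Finset β)
    (f : β → EuclideanSpace ℂ (Fin 3)) :
    Torus.lerayCoeff k (∑ b ∈ s, f b) = ∑ b ∈ s, Torus.lerayCoeff k (f b) := by
  classical
  induction s using Finset.induction_on with
  | empty => simp [lerayCoeff_zero_vec]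
  | insert b s hb ih => rw [Finset.sum_insert hb, Finset.sum_insert hb, lerayCoeff_add', ih]

/-- The complexified lattice vector `k − q` plus `q` is the frequency vector of `k`. -/
theorem cast_sub_add_cast (k q : Fin 3 → ℤ) :
    ((fun j : Fin 3 => (((k - q) j : ℤ) : ℂ)) + fun j : Fin 3 => ((q j : ℤ) : ℂ)) =
      WithLp.ofLp (Torus.freqVec k) := by
  funext j
  simp [Torus.freqVec_apply, Pi.sub_apply]

/-- **One mode of the Lamb form, after projection**: for a Beltrami coefficient `a` at frequency `q`
(`i (q × a) = a`) and any vector `e` at frequency `k − q`,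
`Π_k [a × (i (k−q) × e − e)] = −Π_k [ (i (k−q)·a) e + (i q·e) a ]` (the gradient part `i(a·e)k` is
killed by `Π_k`). -/
theorem lerayCoeff_cross_mode (k q : Fin 3 → ℤ) (a e : EuclideanSpace ℂ (Fin 3))
    (h : Complex.I • ((fun j : Fin 3 => ((q j : ℤ) : ℂ)) ⨯₃ WithLp.ofLp a) = WithLp.ofLp a) :
    Torus.lerayCoeff k (WithLp.toLp 2 (WithLp.ofLp a ⨯₃ (Complex.I • ((fun j : Fin 3 => (((k - q) j : ℤ) :
        ℂ)) ⨯₃ WithLp.ofLp e) - WithLp.ofLp e))) =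
      -Torus.lerayCoeff k ((Complex.I * ∑ j : Fin 3, (((k - q) j : ℤ) : ℂ) * a j) • e +
        (Complex.I * ∑ j : Fin 3, ((q j : ℤ) : ℂ) * e j) • a) := by
  rw [cross_form_pointwise _ _ _ _ h, cast_sub_add_cast]
  have e1 : WithLp.toLp 2 (Complex.I • ((WithLp.ofLp a ⬝ᵥ WithLp.ofLp e) • WithLp.ofLp (Torus.freqVec k)) -
      Complex.I • (((fun j : Fin 3 => (((k - q) j : ℤ) : ℂ)) ⬝ᵥ WithLp.ofLp a) • WithLp.ofLp e) -
      Complex.I • (((fun j : Fin 3 => ((q j : ℤ) : ℂ)) ⬝ᵥ WithLp.ofLp e) • WithLp.ofLp a)) =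
      (Complex.I * (WithLp.ofLp a ⬝ᵥ WithLp.ofLp e)) • Torus.freqVec k -
        ((Complex.I * ∑ j : Fin 3, (((k - q) j : ℤ) : ℂ) * a j) • e +
          (Complex.I * ∑ j : Fin 3, ((q j : ℤ) : ℂ) * e j) • a) := by
    ext p
    simp only [Pi.sub_apply, Pi.smul_apply, smul_eq_mul, dotProduct, PiLp.sub_apply, PiLp.add_apply,
      PiLp.smul_apply]
    ring
  rw [e1, lerayCoeff_sub', lerayCoeff_smul', lerayCoeff_freqVec, smul_zero, zero_sub]

/-- **The certifiers' operator is the tree's linearisation, mode by mode.** For `U = abcFlow A B C`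
(Beltrami: `i q × â(q) = â(q)` on the shell, `Torus.abcCoeff_eigen`) and every coefficient family `c`
and frequency `k`:
`Π_k [N(â, c)(k) + N(c, â)(k)] = −2π · Π_k ∑_y â(q_y) × ( i (k − q_y) × c(k − q_y) − c(k − q_y) )`.
Left: the Fourier side of `P[(U·∇)w + (w·∇)U]` on the unit torus; right: `−2π` times the Fourier side of
`P[U × (curl v − v)]` in period-`2π` units — the advective matrix of INSTAB3-METHOD §1 / SKEWCUT-CERT,
`A[(k,a),(k′,b)] = e_a(k)·(Û_{k−k′} × (i k′ × e_b(k′) − e_b(k′)))`, read on vector-valued families. -/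
theorem lerayCoeff_linSym_abcFlow_eq_cross (A B C : ℝ) (c : (Fin 3 → ℤ) → EuclideanSpace ℂ (Fin 3))
    (k : Fin 3 → ℤ) :
    Torus.lerayCoeff k ((WithLp.toLp 2 (fun pp : Fin 3 => transportSym (fun jj mm => (mFourierCoeff (complexify
        ∘ Torus.abcFlow A B C)) mm jj) (fun mm => c mm pp) k) : EuclideanSpace ℂ (Fin 3)) +
      (WithLp.toLp 2 (fun pp : Fin 3 => transportSym (fun jj mm => c mm jj) (fun mm => (mFourierCoeff
        (complexify ∘ Torus.abcFlow A B C)) mm pp) k) : EuclideanSpace ℂ (Fin 3))) =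
      (-(2 * Real.pi) : ℂ) • Torus.lerayCoeff k (∑ y : Fin 3 × Bool,
        WithLp.toLp 2 (WithLp.ofLp (Torus.abcCoeff A B C (Torus.abcDir y)) ⨯₃
          (Complex.I • ((fun j : Fin 3 => (((k - Torus.abcDir y) j : ℤ) : ℂ)) ⨯₃
            WithLp.ofLp (c (k - Torus.abcDir y))) - WithLp.ofLp (c (k - Torus.abcDir y))))) := by
  have hB : ∀ y : Fin 3 × Bool, Complex.I • ((fun j : Fin 3 => ((Torus.abcDir y j : ℤ) : ℂ)) ⨯₃
      WithLp.ofLp (Torus.abcCoeff A B C (Torus.abcDir y))) =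
      WithLp.ofLp (Torus.abcCoeff A B C (Torus.abcDir y)) := by
    intro y
    funext i
    have h := Torus.abcCoeff_eigen A B C y i
    fin_cases i <;> simpa [cross_apply, Fin.isValue] using h
  rw [lerayCoeff_finset_sum, Finset.smul_sum, linSym_abcFlow_eq, lerayCoeff_finset_sum]
  refine Finset.sum_congr rfl fun y _ => ?_
  rw [lerayCoeff_cross_mode k (Torus.abcDir y) _ _ (hB y), smul_neg, lerayCoeff_add', lerayCoeff_add',
    lerayCoeff_smul', lerayCoeff_smul', lerayCoeff_smul', lerayCoeff_smul', smul_add, smul_smul, smul_smul,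
    neg_add, ← neg_smul, ← neg_smul]
  congr 1
  · congr 1
    ring
  · congr 1
    ring


/-! ### §5 End-to-end: lattice eigenvectors of the ABC linearisation are classical eigenpairs -/

/-- **ABC lattice eigenvector ⇒ classical eigenpair (unit-torus units).** If a rapidly decaying,
transversal, mean-free, non-zero family `c : ℤ³ → ℂ³` solves the CLOSED-FORM lattice eigen-equation
`ν·4π²|k|² c(k) + Π_k ∑_y [ 2πi ((k−q_y)·â(q_y)) c(k−q_y) + 2πi (q_y·c(k−q_y)) â(q_y) ] + μ c(k) = 0`
for all `k` (`q_y = abcDir y`, `â(q_y) = abcCoeff A B C q_y`), then `μ` is an eigenvalue of the linearised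
Navier–Stokes operator about `U = abcFlow A B C` with viscosity `ν`: `Torus.IsLinNSEigenvalue ν U μ`
(KERNEL-CHAIN (A6) SYNTHESIS for the MODEL operator, via `SteadyLattice.isLinNSEigenvalue_of_fourier_eigen`). -/
theorem isLinNSEigenvalue_abcFlow_of_lattice (A B C ν : ℝ) {μ : ℂ}
    {c : (Fin 3 → ℤ) → EuclideanSpace ℂ (Fin 3)} (hc : RapidDecay c)
    (hct : ∀ k : Fin 3 → ℤ, (∑ jj : Fin 3, ((k jj : ℤ) : ℂ) * (c k) jj) = 0) (hc0 : c 0 = 0)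
    (hcne : c ≠ 0)
    (heq : ∀ k : Fin 3 → ℤ, (((ν * (4 * Real.pi ^ 2 * freqNormSq k)) : ℝ) : ℂ) • c k +
      Torus.lerayCoeff k (∑ y : Fin 3 × Bool, ((2 * Real.pi * Complex.I * ∑ j : Fin 3,
          (((k - Torus.abcDir y) j : ℤ) : ℂ) * Torus.abcCoeff A B C (Torus.abcDir y) j) • c (k - Torus.abcDir y) +
        (2 * Real.pi * Complex.I * ∑ j : Fin 3, ((Torus.abcDir y j : ℤ) : ℂ) * c (k - Torus.abcDir y) j) •
          Torus.abcCoeff A B C (Torus.abcDir y))) + μ • c k = 0) :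
    Torus.IsLinNSEigenvalue ν (Torus.abcFlow A B C) μ := by
  refine isLinNSEigenvalue_of_fourier_eigen (Torus.isSmooth_abcFlow A B C) (Torus.isDivFree_abcFlow A B C) hc
    hct hc0 hcne fun k => ?_
  rw [linSym_abcFlow_eq]
  exact heq k

/-- **ABC lattice eigenvector ⇒ classical eigenpair, in the certifiers' form and units.** In period-`2π`
units the certified operator is
`L c (k) = −ν|k|² c(k) + Π_k ∑_y â(q_y) × ( i (k−q_y) × c(k−q_y) − c(k−q_y) )`
(`L v = P[U × (curl v − v)] + νΔv`, INSTAB3-METHOD §1 / SKEWCUT-CERT, class restriction immaterial here).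
If a rapidly decaying, transversal, mean-free, non-zero `c` satisfies `L c = μ c` on the lattice, then
`2πμ` is an eigenvalue of the unit-torus linearisation about `abcFlow A B C` with viscosity `ν/(2π)`:
`Torus.IsLinNSEigenvalue (ν/(2π)) (abcFlow A B C) (2πμ)` — the hypothesis of
`AbcLyapunovInstability.isLyapunovUnstable_abcFlow_of_eigenvalue` (rung R-α) when `Re μ > 0`. -/
theorem isLinNSEigenvalue_abcFlow_of_crossForm (A B C ν : ℝ) {μ : ℂ}
    {c : (Fin 3 → ℤ) → EuclideanSpace ℂ (Fin 3)} (hc : RapidDecay c)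
    (hct : ∀ k : Fin 3 → ℤ, (∑ jj : Fin 3, ((k jj : ℤ) : ℂ) * (c k) jj) = 0) (hc0 : c 0 = 0)
    (hcne : c ≠ 0)
    (heq : ∀ k : Fin 3 → ℤ, (-(((ν * freqNormSq k : ℝ)) : ℂ)) • c k +
      Torus.lerayCoeff k (∑ y : Fin 3 × Bool,
        WithLp.toLp 2 (WithLp.ofLp (Torus.abcCoeff A B C (Torus.abcDir y)) ⨯₃
          (Complex.I • ((fun j : Fin 3 => (((k - Torus.abcDir y) j : ℤ) : ℂ)) ⨯₃
            WithLp.ofLp (c (k - Torus.abcDir y))) - WithLp.ofLp (c (k - Torus.abcDir y))))) = μ • c k) :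
    Torus.IsLinNSEigenvalue (ν / (2 * Real.pi)) (Torus.abcFlow A B C) (2 * Real.pi * μ) := by
  refine isLinNSEigenvalue_of_fourier_eigen (Torus.isSmooth_abcFlow A B C) (Torus.isDivFree_abcFlow A B C) hc
    hct hc0 hcne fun k => ?_
  have hx := lerayCoeff_linSym_abcFlow_eq_cross A B C c k
  have h := heq k
  have hs : ν / (2 * Real.pi) * (4 * Real.pi ^ 2 * freqNormSq k) = 2 * Real.pi * (ν * freqNormSq k) := by
    field_simp
    ring
  rw [hx, hs]
  push_cast
  rw [neg_smul] at h
  linear_combination (norm := module) (-(2 * (Real.pi : ℂ))) • h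

end Summit.NavierStokesRegularity.FluidComputer.AbcLinearisedLattice

end
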